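import Summits.AnomalousDissipation.AnomalousDissipation.Theorems.BaireTransferRobustLoudUpgradeStubSteadyStratumClosed
import Summits.AnomalousDissipation.AnomalousDissipation.Theorems.CoherentStatesSteadyBoundedBranch
import Literature.Analysis.FluidPDE.Onsager1949Proofs

/-!
# Stub `stub_driftClassicalOfWeak` of the line `malkin-cone-group-orbits`
# (crux stmt-AnomalousDissipation-1144, lead c15, wave 3):
# drifted steady weak solution + smooth representative ⇒ classical steady state of mean `m`

A classical steady state of `NS_ν(f)` on `T³` of ANY mean `m` is `u = m + v` with `v` of zero mean;
its mean-zero part `W ∈ H` (represented by `v`) satisfies the DRIFTED steady weak formulation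
`⟨F(W), φ⟩ + ∫ ⟪Dφ(x) m, W(x)⟫ dx = 0` for all `φ ∈ 𝒱` (all derivatives on the test field).  This
file proves the direction "drifted weak + smooth a.e.-representative `v` ⇒ classical": there is a
smooth pressure `p` with `Torus.IsSteadyNSState ν f (m + v) p`, and the budgets are
`∫ (m + v) = m`, `meanEnergy = ‖m‖² + ‖W‖²`, `meanDissipation = (W, f)`.

Proof (reduction to the mean-zero dictionary of `…StubCensusInterior`): the drift term
`x ↦ Dv(x) m = ((m·∇)v)(x)` is smooth, of zero mean, and SKEW (`∫ ⟪Dv·m, φ⟫ = -∫ ⟪v, Dφ·m⟫`, the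
trilinear form with the constant solenoidal field `m`), so `W` is an (undrifted) steady weak
solution for the modified smooth mean-zero force `g = f − Dv·m`; the smooth residual
`g + νΔv − (v·∇)v` is `L²`-orthogonal to `𝒱` and of zero mean, hence a gradient `∇p` (smooth
Helmholtz decomposition `smooth_helmholtz_holds`, exactly as in
`CensusInterior.exists_isSteadyNSState` but starting from the GIVEN representative `v`).  Since
`D(m + v) = Dv`, `Δ(m + v) = Δv`, `div (m + v) = div v` (the landed drift calculus of
`Theorems/CoherentStatesSteadyBoundedBranch.lean`, namespace `CoherentStatesSteadyDrift`), the momentum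
equation of `v` for `g` is that of `m + v` for `f` (`((m+v)·∇)(m+v) = Dv·m + (v·∇)v`).  Budgets:
`‖m + v‖² = ‖m‖² + 2⟪m, v⟫ + ‖v‖²` with `∫ v = 0`; `‖∇(m + v)‖² = ‖∇v‖² = ‖∇W‖²`, the energy
equation `ν‖∇W‖² = (W, g)` (`IsSteadyWeakSolution.energy_eq'`) and `(W, g) = (W, f)` by skewness
(`∫ ⟪v, Dv·m⟫ = 0`).
-/

-- `Summit.<Summit>.<Problem>` is the tree's mandated summit-side namespace (CONVENTIONS §2); for this
-- single-conjunct summit the two coincide, so the duplicate is deliberate.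
set_option linter.dupNamespace false

noncomputable section

open scoped BigOperators Topology InnerProductSpace RealInnerProductSpace ENNReal
open Filter Set Function TopologicalSpace MeasureTheory

namespace Summit.AnomalousDissipation.AnomalousDissipation.Theorems.RobustLoudUpgrade.Category

open Literature.Analysis.FunctionSpaces Literature.Analysis.FunctionSpaces.Torus
open Literature.Analysis.FluidPDE Literature.Analysis.FluidPDE.Torus
open Summit.AnomalousDissipation.AnomalousDissipation.Theses.BaireTransfer
open Summit.AnomalousDissipation.AnomalousDissipation.Theorems.DenseLoudDesignerForces
open Summit.AnomalousDissipation.AnomalousDissipation.Theorems.RobustLoudUpgrade.CensusInterior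
-- the landed drift calculus `D(c + g) = Dg`, `Δ(c + g) = Δg`, `div (c + g) = div g` and `div c = 0`
open Summit.AnomalousDissipation.AnomalousDissipation.Theorems.CoherentStatesSteadyDrift
  (torusFderiv_const_add torusLaplacian_const_add torusDivergence_const_add)
open Literature.Analysis.FluidPDE.Onsager1949 (isDivFree_const)

namespace DriftClassical

/-! ## §1 Space operators of `x ↦ m + v x` (the constant is killed) -/

/-- Partial derivatives ignore additive constants: `∂ᵢ(m + v)(x) = ∂ᵢ v(x)` (`deriv_const_add`, no
differentiability needed). [folklore] -/
theorem torusPartialDeriv_const_add {F : Type*} [NormedAddCommGroup F] [NormedSpace ℝ F] (i : Fin 3)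
    (m : F) (v : UnitAddTorus (Fin 3) → F) (x : UnitAddTorus (Fin 3)) :
    partialDeriv i (fun z => m + v z) x = partialDeriv i v x := by
  simp only [Torus.partialDeriv, Torus.lineDeriv, deriv_const_add]

/-- `m + v` is divergence free if `v` is (`CoherentStatesSteadyDrift.torusDivergence_const_add`).
[folklore] -/
theorem isDivFree_const_add {v : UnitAddTorus (Fin 3) → EuclideanSpace ℝ (Fin 3)} (hv : IsDivFree v)
    (m : EuclideanSpace ℝ (Fin 3)) : IsDivFree (fun z => m + v z) := fun x => by
  rw [torusDivergence_const_add]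
  exact hv x

/-- The classical squared gradient norm ignores additive constants. [folklore] -/
theorem gradNormSq_const_add (m : EuclideanSpace ℝ (Fin 3))
    (v : UnitAddTorus (Fin 3) → EuclideanSpace ℝ (Fin 3)) :
    gradNormSq (fun z => m + v z) = gradNormSq v := by
  unfold gradNormSq
  simp only [torusPartialDeriv_const_add]

/-- The spectral squared gradient norm of a smooth field ignores additive constants (both fields are
smooth, so both sides are `ofReal` of the classical norms). [folklore] -/
theorem eGradNormSq_const_add {v : UnitAddTorus (Fin 3) → EuclideanSpace ℝ (Fin 3)} (hv : IsSmooth v)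
    (m : EuclideanSpace ℝ (Fin 3)) : eGradNormSq (fun z => m + v z) = eGradNormSq v := by
  have hs : IsSmooth (fun z => m + v z) := (isSmooth_const m).add hv
  rw [eGradNormSq_eq_ofReal_gradNormSq hs, eGradNormSq_eq_ofReal_gradNormSq hv, gradNormSq_const_add]

/-! ## §2 The drift term `x ↦ Dv(x) m = ((m·∇)v)(x)`: smooth, mean zero, skew -/

/-- The drift term `x ↦ Dv(x) m` of a smooth field is smooth (it is `convect (fun _ => m) v`).
[folklore] -/
theorem isSmooth_fderiv_apply_const {v : UnitAddTorus (Fin 3) → EuclideanSpace ℝ (Fin 3)}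
    (hv : IsSmooth v) (m : EuclideanSpace ℝ (Fin 3)) : IsSmooth (fun x => Torus.fderiv v x m) :=
  (isSmooth_const m).convect hv

/-- The drift term has zero mean: `∫ Dv(x) m dx = 0` (transport identity with the constant solenoidal
field `m`). [folklore] -/
theorem integral_fderiv_apply_const {v : UnitAddTorus (Fin 3) → EuclideanSpace ℝ (Fin 3)}
    (hv : IsSmooth v) (m : EuclideanSpace ℝ (Fin 3)) : ∫ x, Torus.fderiv v x m = 0 :=
  integral_fderiv_apply_eq_zero_of_isDivFree (isSmooth_const m) hv (isDivFree_const m)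

/-- **Skewness of the drift term**: `∫ ⟪Dv(x) m, w(x)⟫ = -∫ ⟪v(x), Dw(x) m⟫` for smooth `v`, `w`
(antisymmetry of the trilinear form `b(m, v, w) = -b(m, w, v)` with the constant solenoidal field `m`;
Temam, Ch. II §1.2, Lemma 1.3). [folklore] -/
theorem integral_inner_fderiv_apply_const_eq_neg {v w : UnitAddTorus (Fin 3) → EuclideanSpace ℝ (Fin 3)}
    (hv : IsSmooth v) (hw : IsSmooth w) (m : EuclideanSpace ℝ (Fin 3)) :
    ∫ x, ⟪Torus.fderiv v x m, w x⟫_ℝ = -∫ x, ⟪v x, Torus.fderiv w x m⟫_ℝ :=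
  integral_inner_convect_eq_neg (isSmooth_const m) (isDivFree_const m) hv hw

/-- `∫ ⟪v(x), Dv(x) m⟫ dx = 0` for smooth `v` (skewness with `w = v`). [folklore] -/
theorem integral_inner_self_fderiv_apply_const {v : UnitAddTorus (Fin 3) → EuclideanSpace ℝ (Fin 3)}
    (hv : IsSmooth v) (m : EuclideanSpace ℝ (Fin 3)) : ∫ x, ⟪v x, Torus.fderiv v x m⟫_ℝ = 0 := by
  have h := integral_inner_fderiv_apply_const_eq_neg hv hv m
  have h2 : ∫ x, ⟪Torus.fderiv v x m, v x⟫_ℝ = ∫ x, ⟪v x, Torus.fderiv v x m⟫_ℝ :=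
    integral_congr_ae (ae_of_all _ fun x => real_inner_comm _ _)
  linarith

/-! ## §3 Drifted weak ⇒ undrifted weak for the modified force `g = f − Dv·m` -/

/-- **Absorbing the drift into the force.**  If `W ∈ H` with smooth a.e.-representative `v` solves
the drifted steady weak formulation `⟨F_f(W), w⟩ + ∫ ⟪Dw·m, W⟫ = 0` on `𝒱`, then `W` is a steady
weak solution for the modified force `g = f − Dv·m`:
`(g, w) = (f, w) − ∫ ⟪Dv·m, w⟫ = (f, w) + ∫ ⟪v, Dw·m⟫ = (f, w) + ∫ ⟪Dw·m, W⟫`. [folklore] -/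
theorem isSteadyWeakSolution_drift {ν : ℝ} {m : EuclideanSpace ℝ (Fin 3)}
    {f v : UnitAddTorus (Fin 3) → EuclideanSpace ℝ (Fin 3)} {W : energySpace (Fin 3)}
    (hf : IsSmooth f) (hv : IsSmooth v)
    (hae : (W.1 : UnitAddTorus (Fin 3) → EuclideanSpace ℝ (Fin 3)) =ᵐ[volume] v)
    (hW : ∀ w : UnitAddTorus (Fin 3) → EuclideanSpace ℝ (Fin 3), IsSmooth w → IsDivFree w →
      HasZeroMean w → nsGeneratorPairing ν f W w +
        ∫ x, ⟪Torus.fderiv w x m, (W.1 : UnitAddTorus (Fin 3) → EuclideanSpace ℝ (Fin 3)) x⟫_ℝ = 0) :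
    IsSteadyWeakSolution ν (fun x => f x - Torus.fderiv v x m) W := by
  intro w hw hwd hwm
  have h0 := hW w hw hwd hwm
  have e1 : ∫ x, ⟪Torus.fderiv w x m, (W.1 : UnitAddTorus (Fin 3) → EuclideanSpace ℝ (Fin 3)) x⟫_ℝ =
      ∫ x, ⟪v x, Torus.fderiv w x m⟫_ℝ :=
    integral_congr_ae (by filter_upwards [hae] with x hx; rw [hx, real_inner_comm])
  unfold nsGeneratorPairing at h0 ⊢
  have e2 : ∫ x, ⟪f x - Torus.fderiv v x m, w x⟫_ℝ =
      (∫ x, ⟪f x, w x⟫_ℝ) - ∫ x, ⟪Torus.fderiv v x m, w x⟫_ℝ := by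
    simp_rw [inner_sub_left]
    exact integral_sub (hf.inner hw).integrable
      ((isSmooth_fderiv_apply_const hv m).inner hw).integrable
  rw [e2, integral_inner_fderiv_apply_const_eq_neg hv hw m, ← e1]
  linarith

/-! ## §4 Pressure recovery from a smooth representative (the mean-zero dictionary, from `v`) -/

-- adapted from Theorems/BaireTransferRobustLoudUpgradeStubCensusInterior.lean (`exists_isSteadyNSState`),
-- starting from a GIVEN smooth representative instead of Temam's regularity theorem
/-- **Weak → classical with a given smooth representative.**  If `u ∈ H` is a steady weak solution
of `NS_ν(f)` (`f` smooth of zero mean) and `v` is a smooth a.e.-representative of `u`, then `v` is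
divergence free, of zero mean, and solves the steady equations classically with a smooth pressure:
`(v·∇)v = νΔv − ∇p + f`.  The pressure is the Helmholtz potential of the smooth residual
`f + νΔv − (v·∇)v`, whose solenoidal part vanishes (the residual is `L²`-orthogonal to `𝒱` by the
weak formulation integrated by parts, and has zero mean). [folklore] -/
theorem exists_pressure {f : UnitAddTorus (Fin 3) → EuclideanSpace ℝ (Fin 3)} (hf : IsSmooth f)
    (hf0 : HasZeroMean f) {ν : ℝ} {u : energySpace (Fin 3)} (hu : IsSteadyWeakSolution ν f u)
    {v : UnitAddTorus (Fin 3) → EuclideanSpace ℝ (Fin 3)} (hv : IsSmooth v)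
    (hae : (u.1 : UnitAddTorus (Fin 3) → EuclideanSpace ℝ (Fin 3)) =ᵐ[volume] v) :
    ∃ p : UnitAddTorus (Fin 3) → ℝ, IsSmooth p ∧ IsDivFree v ∧ HasZeroMean v ∧
      ∀ x, convect v v x = ν • laplacian v x - Torus.gradient p x + f x := by
  have hL2 : MemLp (u.1 : UnitAddTorus (Fin 3) → EuclideanSpace ℝ (Fin 3)) 2 volume := Lp.memLp _
  -- zero mean and incompressibility of the smooth representative
  have hv0 : HasZeroMean v := by
    unfold HasZeroMean
    rw [← integral_eq_zero_of_mem_energySpace u.2]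
    exact integral_congr_ae hae.symm
  have hdiv : IsDivFree v := by
    refine isDivFree_of_sum_mul_mFourierCoeff_eq_zero hv fun k => ?_
    rw [← mFourierCoeff_congr_ae (hae.fun_comp EuclideanSpace.complexify) k]
    exact (isWeaklyDivFree_of_mem_energySpace u.2).sum_mul_mFourierCoeff_eq_zero hL2 k
  -- the smooth residual, orthogonal to smooth solenoidal mean-zero fields, of zero mean
  set R : UnitAddTorus (Fin 3) → EuclideanSpace ℝ (Fin 3) := f + ν • laplacian v - convect v v
  have hRx : ∀ x, R x = f x + ν • laplacian v x - convect v v x := fun x => rfl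
  have hRs : IsSmooth R := (hf.add (hv.laplacian.smul ν)).sub (hv.convect hv)
  have horth : ∀ w : UnitAddTorus (Fin 3) → EuclideanSpace ℝ (Fin 3), IsSmooth w → IsDivFree w →
      HasZeroMean w → ∫ x, ⟪R x, w x⟫_ℝ = 0 := by
    intro w hw hwd hwm
    have h0 := hu w hw hwd hwm
    unfold nsGeneratorPairing inertialPairing at h0
    have e1 : ∫ x, ⟪(u.1 : UnitAddTorus (Fin 3) → EuclideanSpace ℝ (Fin 3)) x, laplacian w x⟫_ℝ =
        ∫ x, ⟪v x, laplacian w x⟫_ℝ :=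
      integral_congr_ae (by filter_upwards [hae] with x hx; rw [hx])
    have e2 : ∫ x, ⟪Torus.fderiv w x ((u.1 : UnitAddTorus (Fin 3) → EuclideanSpace ℝ (Fin 3)) x),
        (u.1 : UnitAddTorus (Fin 3) → EuclideanSpace ℝ (Fin 3)) x⟫_ℝ =
        ∫ x, ⟪convect v w x, v x⟫_ℝ :=
      integral_congr_ae (by filter_upwards [hae] with x hx; rw [hx]; rfl)
    rw [e1, e2, ← integral_inner_laplacian_comm hv hw,
      integral_inner_convect_eq_neg hv hdiv hw hv] at h0
    have e3 : ∀ x, ⟪R x, w x⟫_ℝ =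
        ⟪f x, w x⟫_ℝ + ν * ⟪laplacian v x, w x⟫_ℝ - ⟪w x, convect v v x⟫_ℝ := fun x => by
      rw [hRx, inner_sub_left, inner_add_left, real_inner_smul_left,
        real_inner_comm (w x) (convect v v x)]
    simp_rw [e3]
    have i1 : Integrable (fun x => ⟪f x, w x⟫_ℝ) volume := (hf.inner hw).integrable
    have i2 : Integrable (fun x => ν * ⟪laplacian v x, w x⟫_ℝ) volume :=
      (hv.laplacian.inner hw).integrable.const_mul ν
    have i3 : Integrable (fun x => ⟪w x, convect v v x⟫_ℝ) volume :=
      (hw.inner (hv.convect hv)).integrable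
    have i12 : Integrable (fun x => ⟪f x, w x⟫_ℝ + ν * ⟪laplacian v x, w x⟫_ℝ) volume := i1.add i2
    rw [integral_sub i12 i3, integral_add i1 i2, integral_const_mul]
    linarith
  have hR0 : HasZeroMean R := by
    show ∫ x, (f x + ν • laplacian v x - convect v v x) = 0
    have i1 : Integrable f volume := hf.integrable
    have i2 : Integrable (fun x => ν • laplacian v x) volume := hv.laplacian.integrable.smul ν
    have i3 : Integrable (fun x => convect v v x) volume := (hv.convect hv).integrable
    have i12 : Integrable (fun x => f x + ν • laplacian v x) volume := i1.add i2
    rw [integral_sub i12 i3, integral_add i1 i2, integral_smul,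
      integral_laplacian_eq_zero_of_isSmooth hv, smul_zero, add_zero,
      integral_convect_self_eq_zero hv hdiv, sub_zero]
    exact hf0
  -- Helmholtz: `R = w₀ + ∇φ`, and `w₀ = 0`
  obtain ⟨w₀, φ, hw₀, hφ, hdiv₀, -, hdec⟩ := smooth_helmholtz_holds (Fin 3) R hRs
  have hw₀m : HasZeroMean w₀ := by
    rw [← hasZeroMean_add_gradient_iff hw₀ hφ, show (fun x => w₀ x + Torus.gradient φ x) = R from
      funext fun x => (hdec x).symm]
    exact hR0
  have hw₀0 : w₀ = 0 := by
    refine eq_zero_of_integral_norm_sq_nonpos hw₀ (le_of_eq ?_)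
    have h1 := horth w₀ hw₀ hdiv₀ hw₀m
    simp_rw [hdec, inner_add_left] at h1
    rw [integral_add (hw₀.inner hw₀).integrable (hφ.gradient.inner hw₀).integrable,
      integral_inner_gradient_eq_zero_of_isDivFree hw₀ hφ hdiv₀, add_zero] at h1
    simpa only [real_inner_self_eq_norm_sq] using h1
  have hmom : ∀ x, R x = Torus.gradient φ x := fun x => by rw [hdec x, hw₀0]; simp
  refine ⟨φ, hφ, hdiv, hv0, fun x => ?_⟩
  rw [← hmom x, hRx]
  abel

end DriftClassical

/-! ## §5 The stub -/

open DriftClassical in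
/-- **stub_driftClassicalOfWeak** (registered sub-goal of lead c15's category package, wave 3).
Drifted weak + smooth representative ⇒ classical steady state `u = m + v` of mean `m` with a smooth
pressure (Helmholtz decomposition of the smooth residual `f + νΔv − (v·∇)v − Dv·m`, which is
`L²`-orthogonal to `𝒱` and of zero mean), with `meanEnergy = ‖m‖² + ‖W‖²`,
`meanDissipation = (W, f)`. [folklore] -/
theorem stub_driftClassicalOfWeak : ∀ (ν : ℝ) (m : EuclideanSpace ℝ (Fin 3)) (f : UnitAddTorus (Fin 3) → EuclideanSpace ℝ (Fin 3))
    (W : energySpace (Fin 3)) (v : UnitAddTorus (Fin 3) → EuclideanSpace ℝ (Fin 3)), 0 < ν → IsSmooth f → HasZeroMean f →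
    W.1 ∈ energySpaceV (Fin 3) →
    (∀ w : UnitAddTorus (Fin 3) → EuclideanSpace ℝ (Fin 3), IsSmooth w → IsDivFree w → HasZeroMean w →
      Torus.nsGeneratorPairing ν f W w +
        ∫ x, ⟪Torus.fderiv w x m, (W.1 : UnitAddTorus (Fin 3) → EuclideanSpace ℝ (Fin 3)) x⟫_ℝ = 0) →
    IsSmooth v → (W.1 : UnitAddTorus (Fin 3) → EuclideanSpace ℝ (Fin 3)) =ᵐ[volume] v →
    ∃ p : UnitAddTorus (Fin 3) → ℝ, Torus.IsSteadyNSState ν f (fun x => m + v x) p ∧ HasZeroMean v ∧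
      (∫ y, (m + v y)) = m ∧
      meanEnergy (fun _ : ℝ => fun x => m + v x) = ‖m‖ ^ 2 + ‖W‖ ^ 2 ∧
      meanDissipation ν (fun _ : ℝ => fun x => m + v x) = Torus.pairing W.1 f := by
  intro ν m f W v _ hf hf0 hV hW hv hae
  -- the modified force `g = f − Dv·m`: smooth, mean zero; `W` is a steady weak solution for `g`
  have hgs : IsSmooth (fun x => f x - Torus.fderiv v x m) :=
    hf.sub (isSmooth_fderiv_apply_const hv m)
  have hg0 : HasZeroMean (fun x => f x - Torus.fderiv v x m) := by
    show ∫ x, (f x - Torus.fderiv v x m) = 0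
    rw [integral_sub hf.integrable (isSmooth_fderiv_apply_const hv m).integrable,
      integral_fderiv_apply_const hv m, sub_zero]
    exact hf0
  have hWg : IsSteadyWeakSolution ν (fun x => f x - Torus.fderiv v x m) W :=
    isSteadyWeakSolution_drift hf hv hae hW
  -- pressure recovery for the representative `v` and the force `g`
  obtain ⟨p, hp, hdiv, hv0, hmom⟩ := exists_pressure hgs hg0 hWg hv hae
  have hus : IsSmooth (fun x => m + v x) := (isSmooth_const m).add hv
  have hiv : ∫ y, v y = 0 := hv0
  refine ⟨p, ⟨isSmoothSpaceTimeOn_const hus _, isSmoothSpaceTimeOn_const hp _, fun t _ x => ?_,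
    fun _ _ => isDivFree_const_add hdiv m⟩, hv0, ?_, ?_, ?_⟩
  · -- momentum: `((m+v)·∇)(m+v) = Dv·m + (v·∇)v = Dv·m + (νΔv − ∇p + (f − Dv·m))`
    have h0 : Torus.timeDerivWithin Set.univ (fun _ : ℝ => fun x => m + v x) t x = 0 := by
      simp [Torus.timeDerivWithin]
    rw [h0, zero_add]
    show Torus.fderiv (fun z => m + v z) x (m + v x) =
      ν • laplacian (fun z => m + v z) x - Torus.gradient p x + f x
    rw [torusFderiv_const_add m v x, torusLaplacian_const_add m v x, map_add]
    have h1 : Torus.fderiv v x (v x) = convect v v x := rfl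
    rw [h1, hmom x]
    abel
  · -- mean: `∫ (m + v) = m + ∫ v = m`
    rw [integral_add (integrable_const m) hv.integrable, integral_const, probReal_univ, one_smul, hiv,
      add_zero]
  · -- energy: `∫ ‖m + v‖² = ‖m‖² + 2⟪m, ∫ v⟫ + ∫ ‖v‖² = ‖m‖² + ‖W‖²`
    rw [meanEnergy_eq_of_periodic (τ := 1) (fun _ => rfl) one_pos]
    have h1 : ∫ x, ‖m + v x‖ ^ 2 = ‖m‖ ^ 2 + ‖W‖ ^ 2 := by
      have h2 : (fun x => ‖m + v x‖ ^ 2) = fun x => (‖m‖ ^ 2 + 2 * ⟪m, v x⟫_ℝ) + ‖v x‖ ^ 2 := by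
        funext x
        exact norm_add_sq_real m (v x)
      have hiV : Integrable (fun _ : UnitAddTorus (Fin 3) => ‖m‖ ^ 2)
          (volume : Measure (UnitAddTorus (Fin 3))) := integrable_const _
      have hiI : Integrable (fun x => 2 * ⟪m, v x⟫_ℝ) (volume : Measure (UnitAddTorus (Fin 3))) :=
        ((isSmooth_const m).inner hv).integrable.const_mul 2
      have hiVI : Integrable (fun x => ‖m‖ ^ 2 + 2 * ⟪m, v x⟫_ℝ)
          (volume : Measure (UnitAddTorus (Fin 3))) := hiV.add hiI
      have hiN : Integrable (fun x => ‖v x‖ ^ 2) (volume : Measure (UnitAddTorus (Fin 3))) :=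
        hv.norm_sq.integrable
      have h3 : ∫ x, ‖v x‖ ^ 2 = ‖W‖ ^ 2 := by
        rw [Submodule.coe_norm, ← integral_norm_sq_coe_eq]
        exact integral_congr_ae (by filter_upwards [hae] with x hx; rw [hx])
      rw [h2, integral_add hiVI hiN, integral_add hiV hiI, integral_const, probReal_univ,
        one_smul, integral_const_mul, integral_inner hv.integrable m, hiv, inner_zero_right, mul_zero,
        add_zero, h3]
    simp [h1]
  · -- dissipation: `ν‖∇(m + v)‖² = ν‖∇W‖² = (W, g) = (W, f)`
    rw [meanDissipation_eq_of_periodic (τ := 1) (fun _ => rfl) one_pos]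
    have h1 : ν * (eGradNormSq (fun x => m + v x)).toReal = Torus.pairing W.1 f := by
      rw [eGradNormSq_const_add hv m, ← eGradNormSq_congr_ae_field hae,
        IsSteadyWeakSolution.energy_eq' (by simp) (hgs.memLp 2) hV hWg]
      simp only [Literature.Analysis.FluidPDE.Torus.pairing]
      have e1 : ∫ x, ⟪(W.1 : UnitAddTorus (Fin 3) → EuclideanSpace ℝ (Fin 3)) x,
          f x - Torus.fderiv v x m⟫_ℝ = ∫ x, ⟪v x, f x - Torus.fderiv v x m⟫_ℝ :=
        integral_congr_ae (by filter_upwards [hae] with x hx; rw [hx])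
      have e2 : ∫ x, ⟪(W.1 : UnitAddTorus (Fin 3) → EuclideanSpace ℝ (Fin 3)) x, f x⟫_ℝ =
          ∫ x, ⟪v x, f x⟫_ℝ :=
        integral_congr_ae (by filter_upwards [hae] with x hx; rw [hx])
      rw [e1, e2]
      simp_rw [inner_sub_right]
      rw [integral_sub (hv.inner hf).integrable (hv.inner (isSmooth_fderiv_apply_const hv m)).integrable,
        integral_inner_self_fderiv_apply_const hv m, sub_zero]
    simp [h1]

end Summit.AnomalousDissipation.AnomalousDissipation.Theorems.RobustLoudUpgrade.Category

end
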